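import Literature.NumberTheory.PAdicHodge.LabelledWeightsTwistUnit
import Literature.NumberTheory.PAdicHodge.LabelledWeightsRankOneThetaPeriodQl
import Literature.NumberTheory.PAdicHodge.FontainePstLabelledWeightsSchemata
import HarnessLib

/-!
# Twisting by a de Rham character shifts the labelled Hodge–Tate weights (proof of the schema)

We prove the named fact `LabelledWeightsTwistSchema` (`FontainePstLabelledWeightsSchemata`): for THE
pinned Fontaine datum `fontainePst K ℓ hK` of an `ℓ`-adic field `K`, a framed
`ρ : Γ_K → GL_n(ℚ̄_ℓ)`, a continuous character `χ : Γ_K → ℚ̄_ℓˣ` with `χ · 1` de Rham, and a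
`ℚ_ℓ`-embedding `τ : K → ℚ̄_ℓ` with `HT_τ(χ · 1) = {k}`:
**`HT_τ(ρ ⊗ χ) = {h + k : h ∈ HT_τ(ρ)}`** (Patrikis, *Variations on a theorem of Tate*, §2.3.1,
§2.7.1; Fontaine, Exp. III §1.5: `D_dR` is a `⊗`-functor).  No de Rham hypothesis on `ρ` is needed.

## Proof

The period ring of THE datum is `B_dR(K)` (accepted `fontainePst_𝔅_eq_bdRPeriodRingData`), a field
filtered by `Fil^i = ξ^i B_dR⁺` with `B_dR⁺` a DVR, so every `z ∈ Fil^i ∖ Fil^{i+1}` has an inverse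
in `Fil^{-i}` (`exists_inv_mem_fil_neg_of_not_mem_fil_succ`).  The de Rham character `χ · 1` has a
finite model `rE' : Γ_K → GL₁(E')` over `E' ⊆ ℚ̄_ℓ` containing the embeddings of `K` (accepted
`HasQlModel`, enlarged by `exists_intermediateField_ge_forall_fieldRange_le`), admissible by model
independence (accepted `IsDeRhamWith.isAdmissible_of_hasQlModel`); `D_{τ₀}(rE')` is an `E'`-line
(accepted `finrank_labelD_eq_of_isAdmissible`) whose labelled weights are those of `χ · 1` at `τ`
(accepted `labelledHodgeTateWeights_conj`, `labelledHodgeTateWeights_baseChange_of_finrank_eq_one`),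
i.e. `{k}`: a generator `d₀` lies in `(E' ⊗ Fil^k) ∖ (E' ⊗ Fil^{k+1})`.  The accepted twisting
theorem for a generator (`RankOneLabelledWeights.labelledHodgeTateWeights_twist_of_generator`,
`LabelledWeightsTwistUnit`) — corner unit + abstract twisting theorem — then gives
`HT_τ(det rE' · ρ) = HT_τ(ρ) + k` over `ℚ̄_ℓ`, and `det rE' = χ` under `E' ⊆ ℚ̄_ℓ`
(accepted `apply_eq_algebraMap_of_hasQlModel`), `(ρ ⊗ χ)(σ) = χ(σ) ρ(σ)`.

## Main statements
* `exists_inv_mem_fil_neg_of_not_mem_fil_succ` — inverses across the `B_dR`-filtration.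
* `labelledHodgeTateWeights_twist_bdR` — the theorem for `bdRPeriodRingData hp` and any
  `ℚ_p`-structure on `F`.
* `LabelledWeightsTwistSchema_holds` — the named fact.

## References
* [Patrikis2019] S. Patrikis, *Variations on a theorem of Tate*, Mem. AMS 1238, §2.3.1, §2.7.1.
* [FontaineAsterisque223III] J.-M. Fontaine, Astérisque 223, Exp. II §1.5.5, Exp. III §1.5,
  Prop. 1.5.2.
* [BrinonConrad2009] O. Brinon, B. Conrad, *CMI notes on p-adic Hodge theory*, §6.3.
-/

noncomputable section

open Field ValuativeRel Matrix TensorProduct WittVector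
open scoped MatrixGroups TensorProduct

namespace Literature.NumberTheory.PAdicHodge

open Literature.NumberTheory.GaloisRepresentations
open Literature.NumberTheory.GaloisRepresentations.IsNonarchimedeanLocalField
open Literature.NumberTheory.Automorphic

namespace RankOneLabelledWeights

-- Mathlib's own global value of `maxSynthPendingDepth` (see `PeriodRingData.rank_D_le`); the large
-- tensor types also need a higher instance-synthesis budget.
set_option maxSynthPendingDepth 3
set_option synthInstance.maxHeartbeats 200000

variable {F : Type} [Field F] [ValuativeRel F] [TopologicalSpace F] [IsNonarchimedeanLocalField F]
  [CharZero F] {p : ℕ} [Fact p.Prime]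

section BdR

variable [Fact (¬ IsUnit (p : integerC F))] [IsAdicComplete (Ideal.span {(p : integerC F)}) (integerC F)]

/-- **Inverses across the `B_dR`-filtration**: an element of `Fil^i B_dR ∖ Fil^{i+1} B_dR` is
`ξ^i · w` with `w` a unit of the DVR `B_dR⁺`, so it has an inverse in `Fil^{-i} B_dR`.
[cite: FontaineAsterisque223III, Exp. II §1.5.5] -/
theorem exists_inv_mem_fil_neg_of_not_mem_fil_succ [Algebra ℚ_[p] F] (hp : valuation F p < 1)
    {i : ℤ} {z : FracBdR F p} (hz : z ∈ (bdRPeriodRingData (F := F) (p := p) hp).fil i)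
    (hz1 : z ∉ (bdRPeriodRingData (F := F) (p := p) hp).fil (i + 1)) :
    ∃ y : FracBdR F p, y ∈ (bdRPeriodRingData (F := F) (p := p) hp).fil (-i) ∧ y * z = 1 := by
  have hF : Function.Surjective (fontaineTheta (integerC F) p) := surjective_fontaineTheta_integerC hp
  haveI : IsDomain (BDeRhamPlus (integerC F) p) := isDomain_bDeRhamPlus hF
  have hξ : ∀ m : ℤ, algebraMap (BDeRhamPlus (integerC F) p) (FracBdR F p) xiBdR ^ m ∈
      (bdRPeriodRingData (F := F) (p := p) hp).fil m := fun m =>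
    (mem_fil_iff hp hF).2 ⟨1, by rw [map_one, mul_one]⟩
  obtain ⟨b, rfl⟩ := (mem_fil_iff hp hF).1 hz
  have hb0 : algebraMap (BDeRhamPlus (integerC F) p) (FracBdR F p) b ∈
      (bdRPeriodRingData (F := F) (p := p) hp).fil 0 := algebraMap_mem_fil_zero hp hF b
  have hb1 : algebraMap (BDeRhamPlus (integerC F) p) (FracBdR F p) b ∉
      (bdRPeriodRingData (F := F) (p := p) hp).fil 1 := fun h =>
    hz1 ((bdRPeriodRingData (F := F) (p := p) hp).mul_mem_fil i 1 _ _ (hξ i) h)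
  obtain ⟨c, hc0, hbc⟩ := BdRTateGraded.exists_inv_of_not_mem_fil_one hp hF hb0 hb1
  refine ⟨algebraMap (BDeRhamPlus (integerC F) p) (FracBdR F p) xiBdR ^ (-i) * c, ?_, ?_⟩
  · have h' := (bdRPeriodRingData (F := F) (p := p) hp).mul_mem_fil (-i) 0 _ c (hξ (-i)) hc0
    rwa [add_zero] at h'
  · rw [mul_mul_mul_comm, ← zpow_add₀ (algebraMap_xiBdR_ne_zero hF), neg_add_cancel, zpow_zero,
      one_mul, mul_comm, hbc]

-- one long declaration (model enlargement + generator bookkeeping over `↥E'`) needs a larger budget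
set_option maxHeartbeats 800000 in
/-- **Twisting by a de Rham character shifts the labelled weights — for `B_dR(F)` and any
`ℚ_p`-structure on `F`.**  For `ρ : Γ_F → GL_n(ℚ̄_p)`, a continuous `χ : Γ_F → ℚ̄_pˣ` with `χ · 1`
de Rham (`IsDeRhamWith … (bdRPeriodRingData hp)`) and `HT_τ(χ · 1) = {k}`:
`HT_τ(ρ ⊗ χ) = HT_τ(ρ) + k`. [cite: Patrikis2019, §2.3.1 and §2.7.1]
[cite: FontaineAsterisque223III, Exp. III §1.5, Prop. 1.5.2] -/
theorem labelledHodgeTateWeights_twist_bdR [Algebra ℚ_[p] F] [FiniteDimensional ℚ_[p] F]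
    (hp : valuation F p < 1) {n : ℕ} (ρ : FramedRep (absoluteGaloisGroup F) (PadicAlgCl p) n)
    (χ : absoluteGaloisGroup F →ₜ* (PadicAlgCl p)ˣ) (k : ℤ)
    (hχ : FramedRep.IsDeRhamWith ‹Algebra ℚ_[p] F› (bdRPeriodRingData (F := F) (p := p) hp)
      ((FramedRep.scalar (PadicAlgCl p) 1).comp χ))
    (τ : F →ₐ[ℚ_[p]] PadicAlgCl p)
    (hHT : (bdRPeriodRingData (F := F) (p := p) hp).labelledHodgeTateWeights
      (FramedRep.toContinuousRep ((FramedRep.scalar (PadicAlgCl p) 1).comp χ)) τ.toRingHom = {k}) :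
    (bdRPeriodRingData (F := F) (p := p) hp).labelledHodgeTateWeights
        (FramedRep.toContinuousRep (ρ.twist χ)) τ.toRingHom =
      ((bdRPeriodRingData (F := F) (p := p) hp).labelledHodgeTateWeights
        (FramedRep.toContinuousRep ρ) τ.toRingHom).map (· + k) := by
  classical
  have hF : Function.Surjective (fontaineTheta (integerC F) p) := surjective_fontaineTheta_integerC hp
  haveI : IsDomain (BDeRhamPlus (integerC F) p) := isDomain_bDeRhamPlus hF
  haveI : Algebra.IsSeparable ℚ_[p] F := Algebra.IsSeparable.of_integral ℚ_[p] F
  set 𝔅 := bdRPeriodRingData (F := F) (p := p) hp with h𝔅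
  -- the section `ι : F̄ → B_dR⁺ ⊆ B_dR` and its properties
  set ιB : AlgebraicClosure F →+* 𝔅.B :=
    (algebraMap (BDeRhamPlus (integerC F) p) (FracBdR F p)).comp (algClosureToBdR hp hF) with hιB
  have hισ : ∀ (σ : absoluteGaloisGroup F) (x : AlgebraicClosure F), σ • ιB x = ιB (σ • x) :=
    smul_algClosureToFracBdR hp
  have hιa : ∀ a : F, ιB (algebraMap F (AlgebraicClosure F) a) = algebraMap F 𝔅.B a :=
    algClosureToFracBdR_algebraMap hp
  have hιfil : ∀ x : AlgebraicClosure F, ιB x ∈ 𝔅.fil 0 := fun x => algebraMap_mem_fil_zero hp hF _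
  have hinv : ∀ (i : ℤ) (z : 𝔅.B), z ∈ 𝔅.fil i → z ∉ 𝔅.fil (i + 1) → ∃ y ∈ 𝔅.fil (-i), y * z = 1 :=
    fun i z hz hz1 => exists_inv_mem_fil_neg_of_not_mem_fil_succ hp hz hz1
  -- Step 1: a finite model `rE'` of `χ · 1` over `E'` containing the embeddings of `F`
  obtain ⟨E₀, hfin₀, rE₀, hmodel₀, -⟩ := id hχ
  haveI : FiniteDimensional ℚ_[p] E₀ := hfin₀
  obtain ⟨E', hfin', hle, hE'⟩ := exists_intermediateField_ge_forall_fieldRange_le (K := F) E₀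
  haveI : FiniteDimensional ℚ_[p] E' := hfin'
  have hsplit := card_algHom_eq_finrank_of_forall_fieldRange_le (K := F) E' hE'
  have hcont : Continuous (IntermediateField.inclusion hle).toRingHom := continuous_inclusion hle
  let rE' : FramedRep (absoluteGaloisGroup F) E' 1 :=
    rE₀.baseChange (IntermediateField.inclusion hle).toRingHom hcont
  obtain ⟨Q, hQ⟩ := hmodel₀
  have hbc : rE'.baseChange (algebraMap E' (PadicAlgCl p)) continuous_subtype_val =
      rE₀.baseChange (algebraMap E₀ (PadicAlgCl p)) continuous_subtype_val :=
    ContinuousMonoidHom.ext fun g => Units.ext (Matrix.ext fun i j => rfl)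
  have hmodel' : HasQlModel ((FramedRep.scalar (PadicAlgCl p) 1).comp χ) E' rE' :=
    ⟨Q, by rw [hbc, hQ]⟩
  have hreq : (FramedRep.scalar (PadicAlgCl p) 1).comp χ =
      (rE'.baseChange (algebraMap E' (PadicAlgCl p)) continuous_subtype_val).conj Q := by
    rw [hbc, hQ]
  have hadm : 𝔅.IsAdmissible ((FramedRep.toContinuousRep rE').restrictScalars ℚ_[p]) :=
    hχ.isAdmissible_of_hasQlModel ‹Algebra ℚ_[p] F› 𝔅 hmodel'
  -- the label factors through `E'`
  let τ₀ : F →ₐ[ℚ_[p]] E' := (IntermediateField.inclusion (hE' τ)).comp τ.equivFieldRange.toAlgHom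
  have hτ : τ.toRingHom = (PeriodRingData.extEmb (E := PadicAlgCl p) τ₀).toRingHom := RingHom.ext fun x => rfl
  have hτ' : (algebraMap E' (PadicAlgCl p)).comp τ₀.toRingHom = τ.toRingHom := RingHom.ext fun x => rfl
  -- Step 2: `D_{τ₀}(rE')` is an `E'`-line with labelled weights `{k}`
  haveI : ContinuousSMul ℚ_[p] E' := IntermediateField.continuousSMul_padicAlgCl E'
  have hB : IsField 𝔅.B := Field.toIsField (FracBdR F p)
  obtain ⟨hfinE', hrank⟩ := 𝔅.finrank_labelD_eq_of_isAdmissible hB (E := E') hsplit rE' hadm τ₀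
  haveI := hfinE'
  set ρr := FramedRep.toContinuousRep rE' with hρr
  have hHT₀ : 𝔅.labelledHodgeTateWeights ρr τ₀.toRingHom = {k} := by
    rw [hρr, ← 𝔅.labelledHodgeTateWeights_baseChange_of_finrank_eq_one rE' continuous_subtype_val
      hsplit τ₀ hrank, ← hτ, ← PeriodRingData.labelledHodgeTateWeights_conj _ _ Q, ← hreq]
    exact hHT
  -- Step 3: a generator `d₀` of `D_{τ₀}(rE')` lies in `(E' ⊗ Fil^k) ∖ (E' ⊗ Fil^{k+1})`
  haveI hfinFil : ∀ i, FiniteDimensional E' (𝔅.labelFilD ρr τ₀.toRingHom i) := fun i =>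
    Submodule.finiteDimensional_of_le (𝔅.labelFilD_le ρr τ₀.toRingHom i)
  have hdle : ∀ i, Module.finrank E' (𝔅.labelFilD ρr τ₀.toRingHom i) ≤ 1 := fun i =>
    (Submodule.finrank_mono (𝔅.labelFilD_le ρr τ₀.toRingHom i)).trans hrank.le
  have hanti : Antitone fun i => Module.finrank E' (𝔅.labelFilD ρr τ₀.toRingHom i) :=
    fun i i' hii' => Submodule.finrank_mono (𝔅.labelFilD_antitone ρr τ₀.toRingHom hii')
  obtain ⟨a, ha⟩ := 𝔅.exists_labelFilD_eq_labelD ρr τ₀.toRingHom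
  obtain ⟨b, hb⟩ := 𝔅.exists_labelFilD_eq_bot ρr τ₀.toRingHom
  have hda : Module.finrank E' (𝔅.labelFilD ρr τ₀.toRingHom a) = 1 := by rw [ha, hrank]
  have hdb : Module.finrank E' (𝔅.labelFilD ρr τ₀.toRingHom b) = 0 := by rw [hb, finrank_bot]
  have hfin : {i : ℤ | Module.finrank E' (𝔅.labelFilD ρr τ₀.toRingHom (i + 1)) <
      Module.finrank E' (𝔅.labelFilD ρr τ₀.toRingHom i)}.Finite := by
    refine (Set.finite_Icc (a - 1) b).subset fun i hi => ?_
    simp only [Set.mem_setOf_eq] at hi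
    refine ⟨?_, ?_⟩
    · by_contra h
      have h1 : Module.finrank E' (𝔅.labelFilD ρr τ₀.toRingHom a) ≤
          Module.finrank E' (𝔅.labelFilD ρr τ₀.toRingHom (i + 1)) := hanti (by push Not at h; omega)
      have h2 := hdle i
      omega
    · by_contra h
      have h1 : Module.finrank E' (𝔅.labelFilD ρr τ₀.toRingHom i) ≤
          Module.finrank E' (𝔅.labelFilD ρr τ₀.toRingHom b) := hanti (by push Not at h; omega)
      omega
  have hjump : Module.finrank E' (𝔅.labelFilD ρr τ₀.toRingHom (k + 1)) <
      Module.finrank E' (𝔅.labelFilD ρr τ₀.toRingHom k) := by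
    have hmem : k ∈ 𝔅.labelledHodgeTateWeights ρr τ₀.toRingHom := by
      rw [hHT₀]; exact Multiset.mem_singleton_self k
    rw [PeriodRingData.labelledHodgeTateWeights_def] at hmem
    exact (mem_jumpMultiset_iff hfin k).1 hmem
  have hdk : Module.finrank E' (𝔅.labelFilD ρr τ₀.toRingHom k) = 1 := by have := hdle k; omega
  have hdk' : Module.finrank E' (𝔅.labelFilD ρr τ₀.toRingHom (k + 1)) = 0 := by
    have := hdle k; omega
  have hFk : 𝔅.labelFilD ρr τ₀.toRingHom k = 𝔅.labelD ρr τ₀.toRingHom :=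
    Submodule.eq_of_le_of_finrank_eq (𝔅.labelFilD_le ρr τ₀.toRingHom k) (by rw [hdk, hrank])
  have hFk' : 𝔅.labelFilD ρr τ₀.toRingHom (k + 1) = ⊥ :=
    (Submodule.eq_of_le_of_finrank_eq bot_le (by rw [finrank_bot, hdk'])).symm
  have hne : 𝔅.labelD ρr τ₀.toRingHom ≠ ⊥ := by
    intro h; rw [h, finrank_bot] at hrank; exact zero_ne_one hrank
  obtain ⟨d₀, hd₀D, hd₀0⟩ := Submodule.exists_mem_ne_zero_of_ne_bot hne
  have hd₀k : d₀ ∈ 𝔅.coeffFilTensor E' (Fin 1 → E') k :=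
    𝔅.labelFilD_le_coeffFilTensor ρr τ₀.toRingHom k (by rw [hFk]; exact hd₀D)
  have hd₀k1 : d₀ ∉ 𝔅.coeffFilTensor E' (Fin 1 → E') (k + 1) := by
    intro h
    have hmem : d₀ ∈ 𝔅.labelFilD ρr τ₀.toRingHom (k + 1) := Submodule.mem_inf.2 ⟨hd₀D, h⟩
    rw [hFk', Submodule.mem_bot] at hmem
    exact hd₀0 hmem
  -- Step 4: `det rE' = χ` under `E' ⊆ ℚ̄_p`, and `(ρ ⊗ χ)(σ) = χ(σ) ρ(σ)`
  have hdet : ∀ σ : absoluteGaloisGroup F,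
      algebraMap E' (PadicAlgCl p) ((FramedRep.det rE' σ : E'ˣ) : E') = (χ σ : PadicAlgCl p) := by
    intro σ
    rw [← hmodel'.coe_det_apply σ, FramedRep.det_apply, Matrix.GeneralLinearGroup.val_det_apply,
      ContinuousMonoidHom.coe_comp, Function.comp_apply, FramedRep.coe_scalar_apply,
      Matrix.det_fin_one, Matrix.algebraMap_matrix_apply, if_pos rfl, Algebra.algebraMap_self_apply]
  have hρ' : ∀ (σ : absoluteGaloisGroup F) (m : Fin n → PadicAlgCl p),
      FramedRep.toContinuousRep (ρ.twist χ) σ m =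
        algebraMap E' (PadicAlgCl p) ((FramedRep.det rE' σ : E'ˣ) : E') •
          FramedRep.toContinuousRep ρ σ m := by
    intro σ m
    rw [FramedRep.toContinuousRep_apply_apply, FramedRep.toContinuousRep_apply_apply,
      FramedRep.coe_twist_apply, Matrix.smul_mulVec, hdet]
  -- Step 5: the twisting theorem for the generator `d₀`
  rw [← hτ']
  exact labelledHodgeTateWeights_twist_of_generator 𝔅 ιB hισ hιa hιfil hinv rE' τ₀ k hd₀D hd₀k
    hd₀k1 (E := PadicAlgCl p) continuous_subtype_val (M := Fin n → PadicAlgCl p)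
    (FramedRep.toContinuousRep ρ) (FramedRep.toContinuousRep (ρ.twist χ)) hρ'

end BdR

end RankOneLabelledWeights

set_option maxSynthPendingDepth 3 in
set_option synthInstance.maxHeartbeats 200000 in
/-- **`LabelledWeightsTwistSchema` holds** (`FontainePstLabelledWeightsSchemata`): for THE pinned
Fontaine datum of an `ℓ`-adic field `K`, twisting `ρ : Γ_K → GL_n(ℚ̄_ℓ)` by a continuous character
`χ` with `χ · 1` de Rham and `HT_τ(χ · 1) = {k}` shifts the `τ`-labelled Hodge–Tate weights by `k`:
`HT_τ(ρ ⊗ χ) = {h + k : h ∈ HT_τ(ρ)}`.  The period ring of THE datum is `B_dR(K)`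
(`fontainePst_𝔅_eq_bdRPeriodRingData`), so this is `labelledHodgeTateWeights_twist_bdR`.
[cite: Patrikis2019, §2.3.1 and §2.7.1] [cite: FontaineAsterisque223III, Exp. III §1.5, Prop. 1.5.2]
[cite: BrinonConrad2009, §6.3] -/
theorem LabelledWeightsTwistSchema_holds : LabelledWeightsTwistSchema := by
  intro ℓ _ K _ _ _ _ _ hK n ρ χ k hχ τ hHT
  haveI : Fact (¬ IsUnit ((ℓ : ℕ) : integerC K)) := ⟨not_isUnit_natCast_integerC hK⟩
  haveI : IsAdicComplete (Ideal.span {((ℓ : ℕ) : integerC K)}) (integerC K) :=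
    isAdicComplete_integerC_natCast hK
  letI := (fontainePst K ℓ hK).algebra
  haveI : FiniteDimensional ℚ_[ℓ] K := fontainePst_finiteDimensional hK
  have hχ' : FramedRep.IsDeRhamWith (fontainePst K ℓ hK).algebra
      (bdRPeriodRingData (F := K) (p := ℓ) hK) ((FramedRep.scalar (PadicAlgCl ℓ) 1).comp χ) := by
    rw [← fontainePst_𝔅_eq_bdRPeriodRingData hK]; exact hχ
  rw [fontainePst_𝔅_eq_bdRPeriodRingData hK] at hHT ⊢
  exact RankOneLabelledWeights.labelledHodgeTateWeights_twist_bdR hK ρ χ k hχ' τ hHT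

end Literature.NumberTheory.PAdicHodge
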